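import Literature.MathematicalPhysics.QuantumLattice.DWaveSourceProofs
import Literature.MathematicalPhysics.QuantumLattice.LiebFluxPhaseProofs
import Literature.MathematicalPhysics.QuantumLattice.SectorSpectrum
import Literature.MathematicalPhysics.QuantumLattice.HubbardWave0RepulsiveProofs
import Literature.MathematicalPhysics.QuantumLattice.PairFieldMomentum
import Literature.MathematicalPhysics.QuantumLattice.HubbardModelGrandCanonicalProofs
import Literature.MathematicalPhysics.QuantumLattice.DWaveSourceFreePressure

/-!
# Crux `TwSeededEnsembleEquivalence` (stmt-HubbardSuperconductivity-1698), line `exposed-density-duality` — stub `stub_groundSectorExists`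

Ground-sector existence: `Hgc μ = Hcan − μN̂` is block-diagonal in the particle number, so its ground energy is attained in some sector `N ≤ 2L²` and lies below every sector value `E_N − μN` (`E_N = Hcan.minEnergyOn (nParticleSubmodule N)`).

Notation: `P = (pairField dWaveFormFactor L)ᴴ * pairField dWaveFormFactor L`,
`Hgc = hubbardTorusWith 2 L 1 U μ − (g/L²) P`, `Hcan = hubbardTorus 2 L 1 U − (g/L²) P`,
`Hgc = Hcan − μ N̂` (`hubbardTorusWith_eq`). Proof (Lieb, PRL 62 (1989) 1201, §2; folklore linear
algebra):

* `≤` (part 2): every unit `N`-particle vector `ψ` is a trial vector for `Hgc`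
  (`Matrix.groundEnergy_le_rayleigh_holds`) and `Re⟨ψ, Hgc ψ⟩ = Re⟨ψ, Hcan ψ⟩ − μN` (`N̂ψ = Nψ`);
  the Rayleigh set of the sector is nonempty for `N ≤ 2L² = |Orb|` (a basis vector), so `le_csInf`.
* `=` (part 1): `Hgc` commutes with `N̂ = diag(#s)` (`hamiltonianWith_commute_totalNumber`,
  `totalNumber_commute_conjTranspose_pairFieldAt_mul_self` at momentum `0`), hence has no matrix
  entries between occupation sets of different cardinality; the restriction of a ground vector of
  `Hgc` (`Matrix.groundSpace_ne_bot_holds`) to a cardinality sector where it does not vanish is again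
  an eigenvector with the ground eigenvalue; normalised, its `Hcan`-Rayleigh quotient is
  `E₀(Hgc) + μN ≥ E_N`, and part 2 gives equality.

Imports are `Literature.*` only (no `…Theses.ThermalWedge` in the import closure), so this module can
be imported by a closing module without an import cycle.
-/

namespace Summit.HubbardSuperconductivity.HubbardSuperconductivity.Theorems.TwSeededEnsembleEquivalence.ExposedDensity

open Matrix Filter Topology Literature.MathematicalPhysics.QuantumLattice
open scoped ComplexOrder Matrix.Norms.L2Operator

noncomputable section

/-- **Particle-number conservation in the occupation basis.** An operator commuting with the
total number operator `N̂ = diag(#s)` has no matrix entries between basis states of different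
cardinality. [folklore] -/
-- adapted from `WcbcsGcGroundEnergy.apply_eq_zero_of_card_ne`
-- (Theorems/WeakCouplingBCSWcbcsBcsConstructionGcGroundEnergyEqMin.lean)
private theorem apply_eq_zero_of_card_ne {Λ : Type*} [LinearOrder Λ] [Fintype Λ]
    {K : Matrix (Finset (Orb Λ)) (Finset (Orb Λ)) ℂ}
    (hK : Commute K totalNumber) {s u : Finset (Orb Λ)} (hsu : s.card ≠ u.card) : K s u = 0 := by
  rw [← totalNumberOp_eq_totalNumber, totalNumberOp_eq_diagonal] at hK
  have h1 := congrFun (congrFun hK.eq s) u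
  rw [mul_diagonal, diagonal_mul] at h1
  have h2 : ((u.card : ℂ) - s.card) * K s u = 0 := by linear_combination h1
  rcases mul_eq_zero.1 h2 with h3 | h3
  · exact absurd (by exact_mod_cast (sub_eq_zero.1 h3).symm) hsu
  · exact h3

/-- A number-conserving operator commutes with the restriction to a particle-number sector:
`K (v|_{#s = n}) = (K v)|_{#s = n}`. [folklore] -/
-- adapted from `WcbcsGcGroundEnergy.mulVec_sectorRestrict` (same file)
private theorem mulVec_sectorRestrict {Λ : Type*} [LinearOrder Λ] [Fintype Λ]
    {K : Matrix (Finset (Orb Λ)) (Finset (Orb Λ)) ℂ}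
    (hK : Commute K totalNumber) (v : Fock (Orb Λ)) (n : ℕ) :
    K *ᵥ (fun s => if s.card = n then v s else 0) =
      fun s => if s.card = n then (K *ᵥ v) s else 0 := by
  funext s
  simp only [mulVec, dotProduct]
  by_cases hs : s.card = n
  · rw [if_pos hs]
    refine Finset.sum_congr rfl fun u _ => ?_
    by_cases hu : u.card = n
    · rw [if_pos hu]
    · have hsu : s.card ≠ u.card := fun h => hu (h ▸ hs)
      rw [if_neg hu, apply_eq_zero_of_card_ne hK hsu, mul_zero, zero_mul]
  · rw [if_neg hs]
    refine Finset.sum_eq_zero fun u _ => ?_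
    by_cases hu : u.card = n
    · have hsu : s.card ≠ u.card := fun h => hs (h.trans hu)
      rw [apply_eq_zero_of_card_ne hK hsu, zero_mul]
    · rw [if_neg hu, mul_zero]

/-- The seeded grand-canonical Hamiltonian `H(1,U) − μN̂ − (g/L²) Δ_dᴴΔ_d` is Hermitian. [folklore] -/
-- same term as `…TwSeededEnsembleEquivalence.Negative.isHermitian_seededGC` (ObstructionTemplates),
-- restated here to keep this module free of the `Theses.ThermalWedge` import
private theorem isHermitian_seededGC (L : ℕ) [NeZero L] (U μ g : ℝ) :
    (hubbardTorusWith 2 L 1 U μ - ((g / (L : ℝ) ^ 2 : ℝ) : ℂ) •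
      ((pairField dWaveFormFactor L)ᴴ * pairField dWaveFormFactor L)).IsHermitian :=
  (isHermitian_hubbardTorusWith L 1 U μ).sub
    ((pairField_conjTranspose_mul_self_posSemidef dWaveFormFactor L).isHermitian.smul
      (by rw [isSelfAdjoint_iff, Complex.star_def, Complex.conj_ofReal]))

/-- On a unit `N`-particle vector, `Re⟨ψ, (H_g − μN̂) ψ⟩ = Re⟨ψ, H_g ψ⟩ − μN`. [folklore] -/
-- same statement as `…TwSeededEnsembleEquivalence.Negative.re_rayleigh_seededGC` (ObstructionTemplates)
private theorem re_rayleigh_seededGC (L : ℕ) [NeZero L] (U μ g : ℝ) {N : ℕ}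
    {ψ : Fock (Orb (FermionTorus 2 L))} (hN : IsNParticle N ψ) (hψ : star ψ ⬝ᵥ ψ = 1) :
    (star ψ ⬝ᵥ (hubbardTorusWith 2 L 1 U μ - ((g / (L : ℝ) ^ 2 : ℝ) : ℂ) •
      ((pairField dWaveFormFactor L)ᴴ * pairField dWaveFormFactor L)) *ᵥ ψ).re =
      (star ψ ⬝ᵥ (hubbardTorus 2 L 1 U - ((g / (L : ℝ) ^ 2 : ℝ) : ℂ) •
        ((pairField dWaveFormFactor L)ᴴ * pairField dWaveFormFactor L)) *ᵥ ψ).re - μ * N := by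
  have heq : hubbardTorusWith 2 L 1 U μ - ((g / (L : ℝ) ^ 2 : ℝ) : ℂ) •
      ((pairField dWaveFormFactor L)ᴴ * pairField dWaveFormFactor L) =
      (hubbardTorus 2 L 1 U - ((g / (L : ℝ) ^ 2 : ℝ) : ℂ) •
        ((pairField dWaveFormFactor L)ᴴ * pairField dWaveFormFactor L)) - (μ : ℂ) • totalNumber := by
    rw [hubbardTorusWith_eq]; abel
  rw [heq, sub_mulVec, smul_mulVec, totalNumber_mulVec_of_isNParticle hN, smul_smul,
    dotProduct_sub, dotProduct_smul, hψ, Complex.sub_re]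
  simp

/-- The seeded grand-canonical Hamiltonian `H(1,U) − μN̂ − (g/L²) Δ_dᴴΔ_d` conserves the particle
number. [folklore] -/
private theorem seededGC_commute_totalNumber (L : ℕ) [NeZero L] (U μ g : ℝ) :
    Commute (hubbardTorusWith 2 L 1 U μ - ((g / (L : ℝ) ^ 2 : ℝ) : ℂ) •
      ((pairField dWaveFormFactor L)ᴴ * pairField dWaveFormFactor L)) totalNumber := by
  have h1 : Commute (hubbardTorusWith 2 L 1 U μ) totalNumber :=
    hamiltonianWith_commute_totalNumber (fermionTorusGraph 2 L) 1 U μ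
  have h2 : Commute ((pairField dWaveFormFactor L)ᴴ * pairField dWaveFormFactor L) totalNumber := by
    have h := totalNumber_commute_conjTranspose_pairFieldAt_mul_self dWaveFormFactor L 0
    rw [pairFieldAt_zero] at h
    exact h.symm
  exact h1.sub_left (h2.smul_left _)

/-- Ground-sector existence: `Hgc μ = Hcan − μN̂` is block-diagonal in the particle number, so its ground energy is attained in some sector `N ≤ 2L²` and lies below every sector value `E_N − μN` (`E_N = Hcan.minEnergyOn (nParticleSubmodule N)`). -/
theorem stub_groundSectorExists :
    ∀ (L : ℕ) [NeZero L] (U μ g : ℝ),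
      (∃ N : ℕ, N ≤ 2 * L ^ 2 ∧
        (hubbardTorusWith 2 L 1 U μ - ((g / (L : ℝ) ^ 2 : ℝ) : ℂ) •
          ((pairField dWaveFormFactor L)ᴴ * pairField dWaveFormFactor L)).groundEnergy =
        (hubbardTorus 2 L 1 U - ((g / (L : ℝ) ^ 2 : ℝ) : ℂ) •
          ((pairField dWaveFormFactor L)ᴴ * pairField dWaveFormFactor L)).minEnergyOn
            (nParticleSubmodule N) - μ * N) ∧
      ∀ N : ℕ, N ≤ 2 * L ^ 2 →
        (hubbardTorusWith 2 L 1 U μ - ((g / (L : ℝ) ^ 2 : ℝ) : ℂ) •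
          ((pairField dWaveFormFactor L)ᴴ * pairField dWaveFormFactor L)).groundEnergy ≤
        (hubbardTorus 2 L 1 U - ((g / (L : ℝ) ^ 2 : ℝ) : ℂ) •
          ((pairField dWaveFormFactor L)ᴴ * pairField dWaveFormFactor L)).minEnergyOn
            (nParticleSubmodule N) - μ * N := by
  intro L _ U μ g
  set Kg := hubbardTorusWith 2 L 1 U μ - ((g / (L : ℝ) ^ 2 : ℝ) : ℂ) •
    ((pairField dWaveFormFactor L)ᴴ * pairField dWaveFormFactor L) with hKgdef
  set Hg := hubbardTorus 2 L 1 U - ((g / (L : ℝ) ^ 2 : ℝ) : ℂ) •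
    ((pairField dWaveFormFactor L)ᴴ * pairField dWaveFormFactor L) with hHgdef
  have hK : Kg.IsHermitian := isHermitian_seededGC L U μ g
  have hH : Hg.IsHermitian := by
    have h := isHermitian_seededGC L U 0 g
    rwa [hubbardTorusWith_zero] at h
  have hcard : Fintype.card (Orb (FermionTorus 2 L)) = 2 * L ^ 2 := card_orb_fermionTorus_two
  -- the Rayleigh identity `Re⟨ψ, Kg ψ⟩ = Re⟨ψ, Hg ψ⟩ - μN` on unit `N`-particle vectors
  have hray : ∀ {N : ℕ} {ψ : Fock (Orb (FermionTorus 2 L))}, IsNParticle N ψ → star ψ ⬝ᵥ ψ = 1 →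
      (star ψ ⬝ᵥ Kg *ᵥ ψ).re = (star ψ ⬝ᵥ Hg *ᵥ ψ).re - μ * N :=
    fun hN hψ => re_rayleigh_seededGC L U μ g hN hψ
  -- the sector Rayleigh sets of `Hg` are bounded below (by `E₀(Hg)`)
  have hbdd : ∀ N : ℕ, BddBelow {E : ℝ | ∃ ψ ∈ nParticleSubmodule (ι := Orb (FermionTorus 2 L)) N,
      star ψ ⬝ᵥ ψ = 1 ∧ E = (star ψ ⬝ᵥ Hg *ᵥ ψ).re} := fun N =>
    ⟨Hg.groundEnergy, by
      rintro E ⟨ψ, -, hψ1, rfl⟩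
      exact groundEnergy_le_rayleigh_holds hH ψ hψ1⟩
  -- part 2: `E₀(Kg) ≤ E_N - μ N` for `N ≤ 2L²`
  have part2 : ∀ N : ℕ, N ≤ 2 * L ^ 2 →
      Kg.groundEnergy ≤ Hg.minEnergyOn (nParticleSubmodule N) - μ * N := by
    intro N hN
    have hne : {E : ℝ | ∃ ψ ∈ nParticleSubmodule (ι := Orb (FermionTorus 2 L)) N,
        star ψ ⬝ᵥ ψ = 1 ∧ E = (star ψ ⬝ᵥ Hg *ᵥ ψ).re}.Nonempty := by
      have hNc : N ≤ (Finset.univ : Finset (Orb (FermionTorus 2 L))).card := by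
        rwa [Finset.card_univ, hcard]
      obtain ⟨s, -, hs⟩ := Finset.exists_subset_card_eq hNc
      refine ⟨_, Pi.single s 1, ?_, ?_, rfl⟩
      · rw [mem_nParticleSubmodule_iff]
        intro s' hs'
        rw [Pi.single_apply, if_neg]
        rintro rfl
        exact hs' hs
      · rw [dotProduct_single, Pi.star_apply, Pi.single_eq_same, star_one, one_mul]
    rw [le_sub_iff_add_le]
    refine le_csInf hne ?_
    rintro E ⟨ψ, hψN, hψ1, rfl⟩
    have h1 := groundEnergy_le_rayleigh_holds hK ψ hψ1
    rw [hray ((mem_nParticleSubmodule_iff N ψ).1 hψN) hψ1] at h1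
    linarith
  refine ⟨?_, part2⟩
  -- part 1: a ground vector of `Kg`, restricted to a sector where it does not vanish
  have hcomm : Commute Kg totalNumber := seededGC_commute_totalNumber L U μ g
  obtain ⟨v, hv, hv0⟩ := (Submodule.ne_bot_iff _).1 (groundSpace_ne_bot_holds hK)
  rw [mem_groundSpace_iff] at hv
  obtain ⟨s₀, hs₀⟩ := Function.ne_iff.1 hv0
  rw [Pi.zero_apply] at hs₀
  have hnle : s₀.card ≤ 2 * L ^ 2 := by rw [← hcard]; exact s₀.card_le_univ
  obtain ⟨w, hw⟩ : ∃ w : Fock (Orb (FermionTorus 2 L)),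
      w = fun s => if s.card = s₀.card then v s else 0 := ⟨_, rfl⟩
  have hw0 : w ≠ 0 := by
    intro h
    have h' := congrFun h s₀
    simp only [hw, Pi.zero_apply, if_pos rfl] at h'
    exact hs₀ h'
  have hwN : IsNParticle s₀.card w := fun s hs => by simp only [hw, if_neg hs]
  have hKw : Kg *ᵥ w = (Kg.groundEnergy : ℂ) • w := by
    rw [hw, mulVec_sectorRestrict hcomm, hv]
    funext s
    simp only [Pi.smul_apply, smul_eq_mul]
    split_ifs <;> simp
  -- normalise it; it is a unit `#s₀`-particle eigenvector of `Kg` with eigenvalue `E₀(Kg)`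
  obtain ⟨c, -, hc1⟩ := exists_smul_unit hw0
  have hφN : IsNParticle s₀.card (c • w) := (nParticleSubmodule s₀.card).smul_mem c hwN
  have hKφ : Kg *ᵥ (c • w) = (Kg.groundEnergy : ℂ) • (c • w) := by
    rw [mulVec_smul, hKw, smul_comm]
  have hE0 : (star (c • w) ⬝ᵥ Kg *ᵥ (c • w)).re = Kg.groundEnergy := by
    rw [hKφ, dotProduct_smul, hc1, smul_eq_mul, mul_one, Complex.ofReal_re]
  -- its `Hg`-energy is `E₀(Kg) + μ #s₀ ≥ E_{#s₀}`
  have hle : Hg.minEnergyOn (nParticleSubmodule s₀.card) ≤ (star (c • w) ⬝ᵥ Hg *ᵥ (c • w)).re :=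
    csInf_le (hbdd _) ⟨c • w, (mem_nParticleSubmodule_iff _ _).2 hφN, hc1, rfl⟩
  have hray1 := hray hφN hc1
  refine ⟨s₀.card, hnle, le_antisymm (part2 _ hnle) ?_⟩
  linarith

end

end Summit.HubbardSuperconductivity.HubbardSuperconductivity.Theorems.TwSeededEnsembleEquivalence.ExposedDensity
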